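import Mathlib
import HarnessLib
import Summits.NavierStokesRegularity.FluidComputer.ColumnarAlignmentZero
import Summits.NavierStokesRegularity.NavierStokesRegularity.Theorems.PoloidalWindowDoorPoloidalWindowRigidityLocalVorticitySymmetry
import Summits.NavierStokesRegularity.NavierStokesRegularity.Theorems.PoloidalWindowDoorLrcModEntireThreadPins
import Summits.NavierStokesRegularity.NavierStokesRegularity.Theorems.PoloidalWindowDoorLrcModEntirePeriodicSlice

/-!
# Item `LrcModEntire` (stmt-NavierStokesRegularity-20428), cell (Q4) — C2 BY VORTICITY `…HorizontalPeriod`: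
# a horizontal PERIOD of the vertical component on the slope slab is a period of the whole slice

ns-k2-port-2 g7, helper of item 20428 (LEAD lineage ns-poloidal-K2-p3; `--supports stmt-NavierStokesRegularity-20428 --as helper`).
Step «FROM `θ` TO `U`» of the LEAD memo `Cruxes/LrcModEntire/T2B-g16.md` §3 (kernel plan §6(iii): C2 `…SliceToField`), for the U-package of the registered
`stub_Q4` (twist_split v8): `U` is a profile of the route's Type-I class, poloidal along `e₂`, in SLOPE FORM `∂₂U_b = μ₁(x₂)·∂_bU₂` (`b = 0,1`) on the
slab `{|x₂| < ρ}` at time `−1`.  The memo does this step with a horizontal div/curl system and the harmonic-gradient Liouville theorem; here it is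
done through the VORTICITY instead, with tree theorems only:

* if `θ := U₂(−1,·)` has a horizontal period `τ` ON THE SLAB (`θ(x + τ) = θ(x)` for `|x₂| < ρ`, `τ₂ = 0`), then so has `∇θ` there, and the slab
  formula `curl U(−1) = ((1−μ₁)∂₁θ, −(1−μ₁)∂₀θ, 0)` (poloidal + slope form; `μ₁(x₂)` is `τ`-invariant, no regularity of `μ₁` used) makes
  `curl U(−1)` `τ`-periodic on the slab (`curl_translate_eq_on_slab_of_horizontalPeriod`);
* the vorticity slice is real-analytic, so the period spreads to `ℝ³` (`curl_translate_eq_of_horizontalPeriod`);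
* a bounded divergence-free `C²` field whose curl is `τ`-periodic is `τ`-periodic (tree `…VorticityTranslate.periodic_of_curl_periodic`):
  ★ `translate_slice_eq_of_horizontalPeriod` — **`U(−1, x + τ) = U(−1, x)` for all `x`**, which is EXACTLY the one-slice input of the periodic
  Liouville endgame E2 (K2-p2 g15 `…LrcModEntirePeriodicSlice.eq_zero_of_periodic_slice_of_class`, conjugation to the axis + tree
  `eq_zero_of_isTypeIAncientMild_of_isAxiallyPeriodic`), and for `τ = le` (all `l`) the input of the tree's `eq_zero_of_translate_eq_slice`
  (`eq_zero_of_horizontalLinePeriod`, the LINE case = E1 in translation currency);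
* ★ `false_of_horizontalPeriod` (+ `_slab`): a horizontal period `τ ≠ 0` of `U₂(−1,·)` on the slab ⇒ `False`, over K2-p2 g15's E2 `…LrcModEntirePeriodicSlice` (appended once it landed);
* local currency: `horizontalPeriod_two_of_local` (a period on a nonempty OPEN set spreads to `ℝ³`), `false_of_local_horizontalPeriod_slab`;
* binder currency: `translate_slice_eq_of_horizontalPeriod_slab` takes the slab slope form VERBATIM as registered (`∀ t, |t+1| < ρ → …`, `μ : ℝ → ℝ → ℝ`).

WHAT THIS IS NOT: not a claim about Navier–Stokes regularity and not a proof of `stub_Q4` or of any v9 child — the `θ → U` transfer lemma of the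
periodic sub-case (bears_on LADDER-NS N0 via items 20428 / 19708; OPEN).
-/

set_option linter.style.longLine false
-- the summit and its single sub-problem share the name (CONVENTIONS §1), as in every Theorems file
set_option linter.dupNamespace false

namespace Summit.NavierStokesRegularity.NavierStokesRegularity.Theorems.PoloidalWindowDoorLrcModEntireHorizontalPeriod

open Set Function Filter Topology Metric
open scoped RealInnerProductSpace InnerProductSpace
open Literature.Analysis Literature.Analysis.FluidPDE
open Summit.NavierStokesRegularity.NavierStokesRegularity.Theorems.LocalSineTubeDoorProfileAlignedWindowRigidityAncient
open Summit.NavierStokesRegularity.NavierStokesRegularity.Theorems.PoloidalWindowDoorPoloidalWindowRigidityOneSlice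
open Summit.NavierStokesRegularity.NavierStokesRegularity.Theorems.PoloidalWindowDoorPoloidalWindowRigidityVorticityTranslate
open Summit.NavierStokesRegularity.NavierStokesRegularity.Theorems.PoloidalWindowDoorPoloidalWindowRigidityLocalVorticitySymmetry
open Summit.NavierStokesRegularity.NavierStokesRegularity.Theorems.PoloidalWindowDoorLrcModEntireThreadPins
open Summit.NavierStokesRegularity.FluidComputer.ColumnarAlignmentZero

/-- The slope slab `{|x₂| < ρ}` is open. -/
theorem isOpen_slab (ρ : ℝ) : IsOpen {x : EuclideanSpace ℝ (Fin 3) | |x 2| < ρ} :=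
  isOpen_lt (continuous_abs.comp (EuclideanSpace.proj (𝕜 := ℝ) (2 : Fin 3)).continuous) continuous_const

/-- A period `τ` of `θ` on an open set `S` near `y` and `y + τ` is a period of `Dθ` at `y`: `Dθ(y + τ) = Dθ(y)` (class-free; no differentiability needed,
both sides are the derivative of the same germ). [folklore] -/
theorem fderiv_translate_eq_of_periodOn {θ : EuclideanSpace ℝ (Fin 3) → ℝ} {S : Set (EuclideanSpace ℝ (Fin 3))} (hS : IsOpen S)
    {τ y : EuclideanSpace ℝ (Fin 3)} (hy : y ∈ S) (hper : ∀ x ∈ S, θ (x + τ) = θ x) :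
    fderiv ℝ θ (y + τ) = fderiv ℝ θ y := by
  have hev : (fun x => θ (x + τ)) =ᶠ[𝓝 y] θ := by
    filter_upwards [hS.mem_nhds hy] with x hx
    exact hper x hx
  have hc : fderiv ℝ (fun x => θ (x + τ)) y = fderiv ℝ θ (y + τ) := by
    rw [fderiv_comp_add_right]
  rw [← hc, hev.fderiv_eq]

variable {C : ℝ} {U : ℝ → EuclideanSpace ℝ (Fin 3) → EuclideanSpace ℝ (Fin 3)}

/-- **The vorticity inherits a horizontal period of `U₂(−1,·)` on the slope slab.**  Class (for smoothness of the slice), poloidal along `e₂`,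
slope form `∂₂U_b(−1,x) = μ₁(x₂)∂_bU₂(−1,x)` on `{|x₂| < ρ}`, `τ₂ = 0`, `U₂(−1, x + τ) = U₂(−1, x)` for `|x₂| < ρ` ⇒
`curl U(−1)(y + τ) = curl U(−1)(y)` for `|y₂| < ρ`. -/
theorem curl_translate_eq_on_slab_of_horizontalPeriod (hdec : HasTypeITimeDecay C U) (hcont : ContinuousOn (uncurry U) (Iio (0 : ℝ) ×ˢ univ))
    (hmild : ∀ s t : ℝ, s < t → t < 0 → ∀ x, U t x = UnboundedOperators.heatExtension (U s) (t - s) x - oseenDuhamel 1 s U U t x)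
    (hpol : ∀ s < 0, ∀ q, ⟪curl (U s) q, EuclideanSpace.single 2 1⟫_ℝ = 0)
    {ρ : ℝ} {μ₁ : ℝ → ℝ}
    (hslab : ∀ x : EuclideanSpace ℝ (Fin 3), |x 2| < ρ → ∀ b : Fin 3, b ≠ 2 →
      fderiv ℝ (U (-1)) x (EuclideanSpace.single 2 1) b = μ₁ (x 2) * fderiv ℝ (U (-1)) x (EuclideanSpace.single b 1) 2)
    {τ : EuclideanSpace ℝ (Fin 3)} (hτ2 : τ 2 = 0)
    (hper : ∀ x : EuclideanSpace ℝ (Fin 3), |x 2| < ρ → U (-1) (x + τ) 2 = U (-1) x 2)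
    {y : EuclideanSpace ℝ (Fin 3)} (hy : |y 2| < ρ) : curl (U (-1)) (y + τ) = curl (U (-1)) y := by
  have h1 : (-1 : ℝ) < 0 := by norm_num
  have han : AnalyticOnNhd ℝ (U (-1)) univ := analyticOnNhd_slice hcont (bdd_of_hasTypeITimeDecay hdec) hmild h1
  have hdU : Differentiable ℝ (U (-1)) := fun x => (han x (mem_univ x)).differentiableAt
  -- the third vorticity component vanishes identically (poloidal)
  have hω2 : ∀ q, curl (U (-1)) q 2 = 0 := fun q => by
    have h := hpol (-1) h1 q
    rw [EuclideanSpace.inner_single_right] at h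
    simpa using h
  -- componentwise conversion `(DU(−1)(x) w)₂ = D(U₂(−1,·))(x) w`
  have hcoord : ∀ x w, fderiv ℝ (U (-1)) x w 2 = fderiv ℝ (fun x => U (-1) x 2) x w := fun x w =>
    (fderiv_apply_coord (U (-1)) (hdU x) w 2).symm
  -- the period passes to the gradient of `θ = U₂(−1,·)` on the (open, `τ`-invariant) slab
  have hyτ : (y + τ) 2 = y 2 := by simp [hτ2]
  have hyτ' : |(y + τ) 2| < ρ := by rw [hyτ]; exact hy
  have hgrad : ∀ w, fderiv ℝ (fun x => U (-1) x 2) (y + τ) w = fderiv ℝ (fun x => U (-1) x 2) y w := fun w => by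
    rw [fderiv_translate_eq_of_periodOn (θ := fun x => U (-1) x 2) (isOpen_slab ρ) (τ := τ)
      (show y ∈ {x : EuclideanSpace ℝ (Fin 3) | |x 2| < ρ} from hy) fun x hx => hper x hx]
  ext i
  fin_cases i
  · show curl (U (-1)) (y + τ) 0 = curl (U (-1)) y 0
    rw [curl_apply_zero, curl_apply_zero, hslab _ hyτ' 1 (by decide), hslab _ hy 1 (by decide), hyτ]
    simp only [hcoord]
    rw [hgrad]
  · show curl (U (-1)) (y + τ) 1 = curl (U (-1)) y 1
    rw [curl_apply_one, curl_apply_one, hslab _ hyτ' 0 (by decide), hslab _ hy 0 (by decide), hyτ]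
    simp only [hcoord]
    rw [hgrad]
  · show curl (U (-1)) (y + τ) 2 = curl (U (-1)) y 2
    rw [hω2, hω2]

/-- **… hence on all of `ℝ³`** (the vorticity slice is real-analytic; identity theorem from the nonempty open slab, `ρ > 0`). -/
theorem curl_translate_eq_of_horizontalPeriod (hdec : HasTypeITimeDecay C U) (hcont : ContinuousOn (uncurry U) (Iio (0 : ℝ) ×ˢ univ))
    (hmild : ∀ s t : ℝ, s < t → t < 0 → ∀ x, U t x = UnboundedOperators.heatExtension (U s) (t - s) x - oseenDuhamel 1 s U U t x)
    (hpol : ∀ s < 0, ∀ q, ⟪curl (U s) q, EuclideanSpace.single 2 1⟫_ℝ = 0)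
    {ρ : ℝ} (hρ : 0 < ρ) {μ₁ : ℝ → ℝ}
    (hslab : ∀ x : EuclideanSpace ℝ (Fin 3), |x 2| < ρ → ∀ b : Fin 3, b ≠ 2 →
      fderiv ℝ (U (-1)) x (EuclideanSpace.single 2 1) b = μ₁ (x 2) * fderiv ℝ (U (-1)) x (EuclideanSpace.single b 1) 2)
    {τ : EuclideanSpace ℝ (Fin 3)} (hτ2 : τ 2 = 0)
    (hper : ∀ x : EuclideanSpace ℝ (Fin 3), |x 2| < ρ → U (-1) (x + τ) 2 = U (-1) x 2) :
    ∀ y : EuclideanSpace ℝ (Fin 3), curl (U (-1)) (y + τ) = curl (U (-1)) y := by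
  have h1 : (-1 : ℝ) < 0 := by norm_num
  have hcan : AnalyticOnNhd ℝ (curl (U (-1))) univ := analyticOnNhd_curl_slice hdec hcont hmild h1
  -- the difference `y ↦ curl U(−1)(y + τ) − curl U(−1)(y)` is analytic on `ℝ³` and vanishes on the open slab
  have hgan : AnalyticOnNhd ℝ (fun y => curl (U (-1)) (y + τ) - curl (U (-1)) y) univ := by
    intro y _
    have hsh : AnalyticAt ℝ (fun y : EuclideanSpace ℝ (Fin 3) => y + τ) y := analyticAt_id.add analyticAt_const
    exact ((hcan (y + τ) (mem_univ _)).comp_of_eq hsh rfl).sub (hcan y (mem_univ _))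
  have hev : (fun y => curl (U (-1)) (y + τ) - curl (U (-1)) y) =ᶠ[𝓝 (0 : EuclideanSpace ℝ (Fin 3))] 0 := by
    filter_upwards [(isOpen_slab ρ).mem_nhds (show (0 : EuclideanSpace ℝ (Fin 3)) ∈ {x : EuclideanSpace ℝ (Fin 3) | |x 2| < ρ} by simpa using hρ)]
      with y hy
    simp only [Pi.zero_apply, sub_eq_zero]
    exact curl_translate_eq_on_slab_of_horizontalPeriod hdec hcont hmild hpol hslab hτ2 hper hy
  intro y
  have h := hgan.eqOn_zero_of_preconnected_of_eventuallyEq_zero isPreconnected_univ (mem_univ 0) hev (mem_univ y)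
  simpa [sub_eq_zero] using h

/-- ★ **C2 BY VORTICITY: a horizontal period of `U₂(−1,·)` on the slope slab is a period of the whole slice `U(−1)`.**  Class + poloidal + slope form on
`{|x₂| < ρ}` (`ρ > 0`) + `U₂(−1, x + τ) = U₂(−1, x)` for `|x₂| < ρ` (`τ₂ = 0`) ⇒ `U(−1, x + τ) = U(−1, x)` for ALL `x`
(`curl_translate_eq_of_horizontalPeriod` + tree `periodic_of_curl_periodic`: the slice is `C²`, divergence-free and bounded by the Type-I rate).  This is the
`hslice` input of the periodic Liouville endgame E2. -/
theorem translate_slice_eq_of_horizontalPeriod (hdec : HasTypeITimeDecay C U) (hcont : ContinuousOn (uncurry U) (Iio (0 : ℝ) ×ˢ univ))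
    (hmild : ∀ s t : ℝ, s < t → t < 0 → ∀ x, U t x = UnboundedOperators.heatExtension (U s) (t - s) x - oseenDuhamel 1 s U U t x)
    (hdiv : ∀ t < 0, VectorCalculus.IsDivFree (U t))
    (hpol : ∀ s < 0, ∀ q, ⟪curl (U s) q, EuclideanSpace.single 2 1⟫_ℝ = 0)
    {ρ : ℝ} (hρ : 0 < ρ) {μ₁ : ℝ → ℝ}
    (hslab : ∀ x : EuclideanSpace ℝ (Fin 3), |x 2| < ρ → ∀ b : Fin 3, b ≠ 2 →
      fderiv ℝ (U (-1)) x (EuclideanSpace.single 2 1) b = μ₁ (x 2) * fderiv ℝ (U (-1)) x (EuclideanSpace.single b 1) 2)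
    {τ : EuclideanSpace ℝ (Fin 3)} (hτ2 : τ 2 = 0)
    (hper : ∀ x : EuclideanSpace ℝ (Fin 3), |x 2| < ρ → U (-1) (x + τ) 2 = U (-1) x 2) :
    ∀ x : EuclideanSpace ℝ (Fin 3), U (-1) (x + τ) = U (-1) x := by
  have h1 : (-1 : ℝ) < 0 := by norm_num
  have hC2 : ContDiff ℝ 2 (U (-1)) := (analyticOnNhd_slice hcont (bdd_of_hasTypeITimeDecay hdec) hmild h1).contDiff
  exact periodic_of_curl_periodic hC2 (hdiv (-1) h1) (fun x => hdec (-1) h1 x)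
    (curl_translate_eq_of_horizontalPeriod hdec hcont hmild hpol hρ hslab hτ2 hper)

/-- **Binder currency** (registered `stub_Q4` U-package, twist_split v8): the slab slope form VERBATIM `∀ t, |t + 1| < ρ → ∀ x, |x 2| < ρ → ∀ b ≠ 2,
∂₂U_b(t,x) = μ t (x 2)·∂_bU₂(t,x)` with `μ : ℝ → ℝ → ℝ`. -/
theorem translate_slice_eq_of_horizontalPeriod_slab (hdec : HasTypeITimeDecay C U) (hcont : ContinuousOn (uncurry U) (Iio (0 : ℝ) ×ˢ univ))
    (hmild : ∀ s t : ℝ, s < t → t < 0 → ∀ x, U t x = UnboundedOperators.heatExtension (U s) (t - s) x - oseenDuhamel 1 s U U t x)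
    (hdiv : ∀ t < 0, VectorCalculus.IsDivFree (U t))
    (hpol : ∀ s < 0, ∀ q, ⟪curl (U s) q, EuclideanSpace.single 2 1⟫_ℝ = 0)
    {ρ : ℝ} (hρ : 0 < ρ) {μ : ℝ → ℝ → ℝ}
    (hslabU : ∀ t : ℝ, |t + 1| < ρ → ∀ x : EuclideanSpace ℝ (Fin 3), |x 2| < ρ → ∀ b : Fin 3, b ≠ 2 →
      fderiv ℝ (U t) x (EuclideanSpace.single 2 1) b = μ t (x 2) * fderiv ℝ (U t) x (EuclideanSpace.single b 1) 2)
    {τ : EuclideanSpace ℝ (Fin 3)} (hτ2 : τ 2 = 0)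
    (hper : ∀ x : EuclideanSpace ℝ (Fin 3), |x 2| < ρ → U (-1) (x + τ) 2 = U (-1) x 2) :
    ∀ x : EuclideanSpace ℝ (Fin 3), U (-1) (x + τ) = U (-1) x :=
  translate_slice_eq_of_horizontalPeriod hdec hcont hmild hdiv hpol hρ (μ₁ := μ (-1))
    (fun x hx b hb => hslabU (-1) (by simpa using hρ) x hx b hb) hτ2 hper

/-- **The LINE case (E1 in translation currency): a horizontal direction of periods kills the profile.**  If `U₂(−1, x + le) = U₂(−1, x)` on the slab for
ALL `l` (`e` horizontal, `e ≠ 0`), every `le` is a period of the slice `U(−1)`, and the tree's one-slice line Liouville `…OneSlice.eq_zero_of_translate_eq_slice`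
gives `U ≡ 0` — against the hot centre `U₂(−1,0) ≠ 0`. -/
theorem false_of_horizontalLinePeriod (hdec : HasTypeITimeDecay C U) (hcont : ContinuousOn (uncurry U) (Iio (0 : ℝ) ×ˢ univ))
    (hmild : ∀ s t : ℝ, s < t → t < 0 → ∀ x, U t x = UnboundedOperators.heatExtension (U s) (t - s) x - oseenDuhamel 1 s U U t x)
    (hdiv : ∀ t < 0, VectorCalculus.IsDivFree (U t))
    (hpol : ∀ s < 0, ∀ q, ⟪curl (U s) q, EuclideanSpace.single 2 1⟫_ℝ = 0) (hne : U (-1) 0 2 ≠ 0)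
    {ρ : ℝ} (hρ : 0 < ρ) {μ₁ : ℝ → ℝ}
    (hslab : ∀ x : EuclideanSpace ℝ (Fin 3), |x 2| < ρ → ∀ b : Fin 3, b ≠ 2 →
      fderiv ℝ (U (-1)) x (EuclideanSpace.single 2 1) b = μ₁ (x 2) * fderiv ℝ (U (-1)) x (EuclideanSpace.single b 1) 2)
    {e : EuclideanSpace ℝ (Fin 3)} (he2 : e 2 = 0) (he : e ≠ 0)
    (hper : ∀ (l : ℝ) (x : EuclideanSpace ℝ (Fin 3)), |x 2| < ρ → U (-1) (x + l • e) 2 = U (-1) x 2) : False := by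
  have hinv : ∀ (y : EuclideanSpace ℝ (Fin 3)) (l : ℝ), U (-1) (y + l • e) = U (-1) y := fun y l =>
    translate_slice_eq_of_horizontalPeriod hdec hcont hmild hdiv hpol hρ hslab (τ := l • e) (by simp [he2]) (hper l) y
  have hzero := eq_zero_of_translate_eq_slice hdec hcont hmild hdiv (s := -1) (by norm_num) he hinv
  apply hne
  rw [hzero (-1) (by norm_num) 0]
  rfl


/-! ### The periodic endgame (appended once K2-p2 g15's E2 `…LrcModEntirePeriodicSlice` landed) -/

/-- ★ **A horizontal PERIOD of `U₂(−1,·)` on the slope slab kills the profile.**  Class + poloidal + slope form on `{|x₂| < ρ}` (`ρ > 0`) + a horizontal period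
`τ ≠ 0` (`τ₂ = 0`) of `U₂(−1,·)` on the slab + hot centre `U₂(−1,0) ≠ 0` ⇒ `False`: `translate_slice_eq_of_horizontalPeriod` makes `τ` a period of the whole slice
`U(−1)`, and K2-p2 g15's periodic Liouville endgame E2 `…LrcModEntirePeriodicSlice.eq_zero_of_periodic_slice_of_class` (one periodic slice ⇒ all slices periodic ⇒
conjugate the period to the axis ⇒ tree `eq_zero_of_isTypeIAncientMild_of_isAxiallyPeriodic`) gives `U ≡ 0`. -/
theorem false_of_horizontalPeriod (hdec : HasTypeITimeDecay C U) (hcont : ContinuousOn (uncurry U) (Iio (0 : ℝ) ×ˢ univ))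
    (hmild : ∀ s t : ℝ, s < t → t < 0 → ∀ x, U t x = UnboundedOperators.heatExtension (U s) (t - s) x - oseenDuhamel 1 s U U t x)
    (hdiv : ∀ t < 0, VectorCalculus.IsDivFree (U t))
    (hpol : ∀ s < 0, ∀ q, ⟪curl (U s) q, EuclideanSpace.single 2 1⟫_ℝ = 0) (hne : U (-1) 0 2 ≠ 0)
    {ρ : ℝ} (hρ : 0 < ρ) {μ₁ : ℝ → ℝ}
    (hslab : ∀ x : EuclideanSpace ℝ (Fin 3), |x 2| < ρ → ∀ b : Fin 3, b ≠ 2 →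
      fderiv ℝ (U (-1)) x (EuclideanSpace.single 2 1) b = μ₁ (x 2) * fderiv ℝ (U (-1)) x (EuclideanSpace.single b 1) 2)
    {τ : EuclideanSpace ℝ (Fin 3)} (hτ2 : τ 2 = 0) (hτ : τ ≠ 0)
    (hper : ∀ x : EuclideanSpace ℝ (Fin 3), |x 2| < ρ → U (-1) (x + τ) 2 = U (-1) x 2) : False := by
  have hzero := PoloidalWindowDoorLrcModEntirePeriodicSlice.eq_zero_of_periodic_slice_of_class hdec hcont hmild hdiv hτ (t₀ := -1) (by norm_num)
    (translate_slice_eq_of_horizontalPeriod hdec hcont hmild hdiv hpol hρ hslab hτ2 hper)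
  apply hne
  rw [hzero (-1) (by norm_num) 0]
  rfl

/-- **Binder currency** of `false_of_horizontalPeriod` (registered `stub_Q4` U-package: slab slope form `∀ t, |t + 1| < ρ → …`, `μ : ℝ → ℝ → ℝ`). -/
theorem false_of_horizontalPeriod_slab (hdec : HasTypeITimeDecay C U) (hcont : ContinuousOn (uncurry U) (Iio (0 : ℝ) ×ˢ univ))
    (hmild : ∀ s t : ℝ, s < t → t < 0 → ∀ x, U t x = UnboundedOperators.heatExtension (U s) (t - s) x - oseenDuhamel 1 s U U t x)
    (hdiv : ∀ t < 0, VectorCalculus.IsDivFree (U t))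
    (hpol : ∀ s < 0, ∀ q, ⟪curl (U s) q, EuclideanSpace.single 2 1⟫_ℝ = 0) (hne : U (-1) 0 2 ≠ 0)
    {ρ : ℝ} (hρ : 0 < ρ) {μ : ℝ → ℝ → ℝ}
    (hslabU : ∀ t : ℝ, |t + 1| < ρ → ∀ x : EuclideanSpace ℝ (Fin 3), |x 2| < ρ → ∀ b : Fin 3, b ≠ 2 →
      fderiv ℝ (U t) x (EuclideanSpace.single 2 1) b = μ t (x 2) * fderiv ℝ (U t) x (EuclideanSpace.single b 1) 2)
    {τ : EuclideanSpace ℝ (Fin 3)} (hτ2 : τ 2 = 0) (hτ : τ ≠ 0)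
    (hper : ∀ x : EuclideanSpace ℝ (Fin 3), |x 2| < ρ → U (-1) (x + τ) 2 = U (-1) x 2) : False :=
  false_of_horizontalPeriod hdec hcont hmild hdiv hpol hne hρ (μ₁ := μ (-1))
    (fun x hx b hb => hslabU (-1) (by simpa using hρ) x hx b hb) hτ2 hτ hper


/-! ### Local currency: a period on SOME nonempty open set suffices (the slice is real-analytic) -/

/-- **A local period spreads:** if `U₂(−1, x + τ) = U₂(−1, x)` for `x` in a nonempty open set `V`, then for ALL `x ∈ ℝ³` (identity theorem for the real-analytic
function `x ↦ U₂(−1, x + τ) − U₂(−1, x)`).  This is the bridge from what Cauchy–Kovalevskaya uniqueness across the jet sheet delivers (a neighbourhood of ONE sheet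
point, at any height) to the slab hypothesis `hper` — the centring of the slope slab at height `0` is immaterial (refuter1 g23 K-373 note (i)). -/
theorem horizontalPeriod_two_of_local (hdec : HasTypeITimeDecay C U) (hcont : ContinuousOn (uncurry U) (Iio (0 : ℝ) ×ˢ univ))
    (hmild : ∀ s t : ℝ, s < t → t < 0 → ∀ x, U t x = UnboundedOperators.heatExtension (U s) (t - s) x - oseenDuhamel 1 s U U t x)
    {τ : EuclideanSpace ℝ (Fin 3)} {V : Set (EuclideanSpace ℝ (Fin 3))} (hV : IsOpen V) (hVne : V.Nonempty)
    (hper : ∀ x ∈ V, U (-1) (x + τ) 2 = U (-1) x 2) : ∀ x : EuclideanSpace ℝ (Fin 3), U (-1) (x + τ) 2 = U (-1) x 2 := by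
  have h1 : (-1 : ℝ) < 0 := by norm_num
  have han : AnalyticOnNhd ℝ (U (-1)) univ := analyticOnNhd_slice hcont (bdd_of_hasTypeITimeDecay hdec) hmild h1
  have hθan : AnalyticOnNhd ℝ (fun x => U (-1) x 2) univ := fun x _ =>
    ((EuclideanSpace.proj (𝕜 := ℝ) (2 : Fin 3)).analyticAt _).comp (han x (mem_univ x))
  have hgan : AnalyticOnNhd ℝ (fun x => U (-1) (x + τ) 2 - U (-1) x 2) univ := by
    intro x _
    have hsh : AnalyticAt ℝ (fun y : EuclideanSpace ℝ (Fin 3) => y + τ) x := analyticAt_id.add analyticAt_const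
    exact ((hθan (x + τ) (mem_univ _)).comp_of_eq hsh rfl).sub (hθan x (mem_univ _))
  obtain ⟨x₀, hx₀⟩ := hVne
  have hev : (fun x => U (-1) (x + τ) 2 - U (-1) x 2) =ᶠ[𝓝 x₀] 0 := by
    filter_upwards [hV.mem_nhds hx₀] with x hx
    simp only [Pi.zero_apply, sub_eq_zero]
    exact hper x hx
  intro x
  have h := hgan.eqOn_zero_of_preconnected_of_eventuallyEq_zero isPreconnected_univ (mem_univ x₀) hev (mem_univ x)
  simpa [sub_eq_zero] using h

/-- ★ **The periodic endgame from a LOCAL period** (binder currency): registered slab slope form (`∀ t, |t + 1| < ρ → …`, `0 < ρ`), class, poloidal, a horizontal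
`τ ≠ 0` that is a period of `U₂(−1,·)` on SOME nonempty open set, hot centre `U₂(−1,0) ≠ 0` ⇒ `False`. -/
theorem false_of_local_horizontalPeriod_slab (hdec : HasTypeITimeDecay C U) (hcont : ContinuousOn (uncurry U) (Iio (0 : ℝ) ×ˢ univ))
    (hmild : ∀ s t : ℝ, s < t → t < 0 → ∀ x, U t x = UnboundedOperators.heatExtension (U s) (t - s) x - oseenDuhamel 1 s U U t x)
    (hdiv : ∀ t < 0, VectorCalculus.IsDivFree (U t))
    (hpol : ∀ s < 0, ∀ q, ⟪curl (U s) q, EuclideanSpace.single 2 1⟫_ℝ = 0) (hne : U (-1) 0 2 ≠ 0)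
    {ρ : ℝ} (hρ : 0 < ρ) {μ : ℝ → ℝ → ℝ}
    (hslabU : ∀ t : ℝ, |t + 1| < ρ → ∀ x : EuclideanSpace ℝ (Fin 3), |x 2| < ρ → ∀ b : Fin 3, b ≠ 2 →
      fderiv ℝ (U t) x (EuclideanSpace.single 2 1) b = μ t (x 2) * fderiv ℝ (U t) x (EuclideanSpace.single b 1) 2)
    {τ : EuclideanSpace ℝ (Fin 3)} (hτ2 : τ 2 = 0) (hτ : τ ≠ 0)
    {V : Set (EuclideanSpace ℝ (Fin 3))} (hV : IsOpen V) (hVne : V.Nonempty)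
    (hper : ∀ x ∈ V, U (-1) (x + τ) 2 = U (-1) x 2) : False :=
  false_of_horizontalPeriod_slab hdec hcont hmild hdiv hpol hne hρ hslabU hτ2 hτ
    fun x _ => horizontalPeriod_two_of_local hdec hcont hmild hV hVne hper x

end Summit.NavierStokesRegularity.NavierStokesRegularity.Theorems.PoloidalWindowDoorLrcModEntireHorizontalPeriod
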